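import Summits.BirchSwinnertonDyer.BirchSwinnertonDyer.Theorems.ClassRecordThreeEulerHalvesAtThreeEichlerShimuraLevelCountB
import Summits.BirchSwinnertonDyer.BirchSwinnertonDyer.Theorems.EisensteinDepletionAtTwoStarGO2CuspEvennessELeg
import Literature.GroupTheory.SpecificGroups.ModularGroupFreeProduct
import HarnessLib

/-!
# Shimura's count `dim H¹_P(Γ, ℝ) = 2g` for a general finite-index level, part D: cocycles

Support file for route `ClassRecordThree`, crux `EulerHalvesAtThree` (the `(ES-surj)` step of
`CartanOnePlaceDegreeLawAtThree`), continuing parts A–C (`…EichlerShimuraLevelCount{A,B,C}`),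
which proved the inequality `6 dim_ℝ H¹_P(Γ, ℝ) + 3ε₂ + 4ε₃ + 6ε_∞ ≤ 12 + [SL(2, ℤ) : Γ]`.
Parts D–E prove the reverse inequality, hence Shimura's equality `dim_ℝ H¹_P(Γ, ℝ) = 2g(Γ)`
(part E, `six_mul_finrank_parabolicCocycles_eq`).  This part supplies the three facts about
cocycles `E : SL(2, ℤ) → ℝ^X` (`E(gh) = h^*E(g) + E(h)`, `X = SL(2, ℤ)/Γ`) that make the map `Λ`
of part C onto the solution space:

* **Shapiro injectivity, explicitly** (`rc_eq_tot`): `E = E_u + δf` for the restriction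
  `u(γ) = E(γ)(Γ)` (additive on `Γ`, `rc_apply_coe_one_mul`) and `f(x) = (E - E_u)(s(x))(Γ)`.
* **Parabolicity** (`rc_apply_coe_one_eq_zero_of_isParabolic`): if the cusp sums of `E(T)`
  vanish then `u` kills every parabolic `π ∈ Γ`: `π = ±σT^hσ⁻¹` (the tree's parabolic normal
  form `exists_eq_conj_T_zpow_of_trace_eq_two`), and
  `E(σT^hσ⁻¹)(Γ) = E(T^h)(σ⁻¹Γ) = (h/w) · (cusp sum of E(T) over the ⟨T⟩-orbit of σ⁻¹Γ) = 0`.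
* **Existence** (`exists_rc`): if `(1 + S^*)a = 0` and `(1 + U^* + U^{*2})(T^*a + b) = 0`
  (`U = ST`) there is a cocycle with `E(S) = a`, `E(T) = b` — the universal property of
  `PSL(2, ℤ) = C₂ * C₃`, imported from the tree's `ModularGroupFreeProduct.exists_isCrossedHom`
  applied to the representation `g ↦ (g⁻¹)^*` (`corep`; `F(g) = E(g⁻¹)` converts conventions).

All statements are over `ℝ` and purely combinatorial in the coset action of `SL(2, ℤ)` on `X`.

References: [cite: ShimuraIATAF1971, §1.3, §8.1 (8.1.1)–(8.1.4)];
[cite: Brown1982, III.1 Ex. 2 (cocycles), III.6 (Shapiro)]; [folklore] for the computations.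
-/

open scoped MatrixGroups ModularForm

open CongruenceSubgroup Matrix.SpecialLinearGroup ModularGroup

set_option linter.dupNamespace false

namespace Summit.BirchSwinnertonDyer.BirchSwinnertonDyer.Theorems.EichlerShimuraLevel

open _root_.Module _root_.LinearMap
open Literature.NumberTheory.EllipticCurves.ModularForms
open Literature.GroupTheory.SpecificGroups
open scoped Classical

variable {Γ : Subgroup SL(2, ℤ)}

/-! ### Cocycles of `SL(2, ℤ)` in `ℝ^X` (`E(gh) = h^* E(g) + E(h)`) -/

section RightCocycle

variable {E : SL(2, ℤ) → (SL(2, ℤ) ⧸ Γ) → ℝ}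
  (hE : ∀ g h : SL(2, ℤ), E (g * h) = coperm Γ h (E g) + E h)
include hE

/-- `E(1) = 0`. [folklore] -/
theorem rc_one : E 1 = 0 := by
  have h := hE 1 1
  rw [mul_one, coperm_one, LinearMap.id_apply] at h
  funext x
  have hx := congrFun h x
  simp only [Pi.add_apply] at hx
  simp only [Pi.zero_apply]
  linarith

/-- `E(g⁻¹) = -(g⁻¹)^* E(g)`. [folklore] -/
theorem rc_inv (g : SL(2, ℤ)) : E g⁻¹ = -coperm Γ g⁻¹ (E g) := by
  have h := hE g g⁻¹
  rw [mul_inv_cancel, rc_one hE] at h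
  exact eq_neg_of_add_eq_zero_right h.symm

/-- `E(-1) = 0` when `-1 ∈ Γ` (`2E(-1) = E(1) = 0`). [folklore] -/
theorem rc_neg_one [Fact ((-1 : SL(2, ℤ)) ∈ Γ)] : E (-1) = 0 := by
  have h := hE (-1) (-1)
  rw [neg_mul_neg, one_mul, rc_one hE, coperm_neg_one, LinearMap.id_apply] at h
  funext x
  have hx := congrFun h x
  simp only [Pi.add_apply, Pi.zero_apply] at hx
  simp only [Pi.zero_apply]
  linarith

/-- `E(-g) = E(g)` when `-1 ∈ Γ`. [folklore] -/
theorem rc_neg [Fact ((-1 : SL(2, ℤ)) ∈ Γ)] (g : SL(2, ℤ)) : E (-g) = E g := by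
  have h := hE (-1) g
  rwa [rc_neg_one hE, map_zero, zero_add, neg_one_mul] at h

/-- The restriction `γ ↦ E(γ)(Γ)` is additive on `Γ`. [folklore] -/
theorem rc_apply_coe_one_mul (γ δ : Γ) :
    E ((γ * δ : Γ) : SL(2, ℤ)) ((1 : SL(2, ℤ)) : (SL(2, ℤ) ⧸ Γ)) =
      E γ ((1 : SL(2, ℤ)) : (SL(2, ℤ) ⧸ Γ)) + E δ ((1 : SL(2, ℤ)) : (SL(2, ℤ) ⧸ Γ)) := by
  rw [Subgroup.coe_mul, hE, Pi.add_apply, coperm_apply, smul_coe_one_of_mem δ.2]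

/-- `E(T^n)(y) = ∑_{j<n} E(T)(T^j y)`. [folklore] -/
theorem rc_T_pow_apply (n : ℕ) (y : SL(2, ℤ) ⧸ Γ) :
    E (T ^ n) y = ∑ j ∈ Finset.range n, E T (T ^ j • y) := by
  induction n generalizing y with
  | zero => simp [rc_one hE]
  | succ n ih =>
    rw [pow_succ, hE, Pi.add_apply, coperm_apply, ih, Finset.sum_range_succ']
    simp only [pow_succ, mul_smul, pow_zero, one_smul]

/-- `E(σgσ⁻¹)(Γ) = E(g)(σ⁻¹Γ)` when `g` fixes `σ⁻¹Γ`. [folklore] -/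
theorem rc_conj_apply (σ g : SL(2, ℤ))
    (hg : g • (σ⁻¹ • ((1 : SL(2, ℤ)) : (SL(2, ℤ) ⧸ Γ))) = σ⁻¹ • ((1 : SL(2, ℤ)) : (SL(2, ℤ) ⧸ Γ))) :
    E (σ * g * σ⁻¹) ((1 : SL(2, ℤ)) : (SL(2, ℤ) ⧸ Γ)) =
      E g (σ⁻¹ • ((1 : SL(2, ℤ)) : (SL(2, ℤ) ⧸ Γ))) := by
  rw [hE, hE, rc_inv hE σ]
  simp only [Pi.add_apply, Pi.neg_apply, map_add, coperm_apply, hg]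
  ring

/-- **Shapiro injectivity, explicitly**: a cocycle `E` is `E_u + δf` for its restriction
`u(γ) = E(γ)(Γ)` and `f(x) = (E - E_u)(s(x))(Γ)`. [cite: Brown1982, III.6 (Shapiro's lemma)] -/
theorem rc_eq_tot : ∃ f : (SL(2, ℤ) ⧸ Γ) → ℝ, ∀ g : SL(2, ℤ),
    E g = tot (fun γ : Γ ↦ E γ ((1 : SL(2, ℤ)) : (SL(2, ℤ) ⧸ Γ))) f g := by
  set u : Γ → ℝ := fun γ : Γ ↦ E γ ((1 : SL(2, ℤ)) : (SL(2, ℤ) ⧸ Γ)) with hu_def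
  have hu : ∀ γ δ, u (γ * δ) = u γ + u δ := fun γ δ ↦ rc_apply_coe_one_mul hE γ δ
  have hD : ∀ g h : SL(2, ℤ),
      E (g * h) - lift u (g * h) = coperm Γ h (E g - lift u g) + (E h - lift u h) := by
    intro g h
    rw [hE, lift_mul hu, map_sub]
    abel
  have hD1 : ∀ γ : Γ, E γ ((1 : SL(2, ℤ)) : (SL(2, ℤ) ⧸ Γ)) -
      lift u γ ((1 : SL(2, ℤ)) : (SL(2, ℤ) ⧸ Γ)) = 0 := fun γ ↦ by
    rw [lift_apply_coe_one hu, sub_eq_zero]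
  refine ⟨fun x ↦ (E (sec x) - lift u (sec x)) ((1 : SL(2, ℤ)) : (SL(2, ℤ) ⧸ Γ)), fun g ↦ ?_⟩
  funext x
  have hsx : sec x • ((1 : SL(2, ℤ)) : (SL(2, ℤ) ⧸ Γ)) = x := by
    rw [MulAction.Quotient.smul_mk, smul_eq_mul, mul_one, coe_sec]
  have hrel : g * sec x = sec (g • x) * (liftElem g x : SL(2, ℤ)) := by
    rw [coe_liftElem]; group
  have h1 := congrFun (hD g (sec x)) ((1 : SL(2, ℤ)) : (SL(2, ℤ) ⧸ Γ))
  have h2 := congrFun (hD (sec (g • x)) (liftElem g x)) ((1 : SL(2, ℤ)) : (SL(2, ℤ) ⧸ Γ))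
  rw [hrel] at h1
  simp only [Pi.add_apply, Pi.sub_apply, coperm_apply, hsx,
    smul_coe_one_of_mem (liftElem g x).2] at h1 h2
  simp only [tot, cobd, Pi.add_apply, Pi.sub_apply, coperm_apply]
  linarith [hD1 (liftElem g x)]

variable [Γ.FiniteIndex]

/-- If the cusp sums of `E(T)` vanish and `T^n` fixes `y`, then `E(T^n)(y) = 0`
(`n` is a multiple of the width `w` of `y`, and `E(T^n)(y) = (n/w) ∑_{orbit} E(T)`). [folklore] -/
theorem rc_T_pow_apply_eq_zero (hcusp : cuspSum Γ (E T) = 0) {n : ℕ} {y : SL(2, ℤ) ⧸ Γ}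
    (hy : T ^ n • y = y) : E (T ^ n) y = 0 := by
  obtain ⟨k, rfl⟩ := (Level.T_pow_smul_eq_iff Γ y n).mp hy
  clear hy
  rw [rc_T_pow_apply hE]
  have hone : ∑ j ∈ Finset.range (Level.width Γ y), E T (T ^ j • y) = 0 := by
    have hmem : y ∈ Level.orbitFin Γ (Level.base Γ y) := by
      have h := Level.T_pow_smul_mem_orbitFin Γ (Level.base Γ y) (Level.off Γ y)
      rwa [Level.T_pow_off_smul_base] at h
    rw [← Level.sum_orbitFin_eq, Level.orbitFin_eq_of_mem Γ hmem]
    have h := congrFun hcusp ⟨Level.base Γ y, Level.base_mem_basePoints y⟩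
    rwa [cuspSum_apply] at h
  induction k with
  | zero => simp
  | succ k ih =>
    have hfix : T ^ (Level.width Γ y * k) • y = y :=
      (Level.T_pow_smul_eq_iff Γ y _).mpr (dvd_mul_right _ _)
    rw [Nat.mul_succ, Finset.sum_range_add, ih, zero_add]
    simp_rw [show ∀ x, Level.width Γ y * k + x = x + Level.width Γ y * k from fun x ↦ add_comm _ _,
      pow_add, mul_smul, hfix]
    exact hone

/-- Integer-power version of `rc_T_pow_apply_eq_zero`. [folklore] -/
theorem rc_T_zpow_apply_eq_zero (hcusp : cuspSum Γ (E T) = 0) {h : ℤ} {y : SL(2, ℤ) ⧸ Γ}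
    (hy : T ^ h • y = y) : E (T ^ h) y = 0 := by
  obtain ⟨n, rfl | rfl⟩ := Int.eq_nat_or_neg h
  · rw [zpow_natCast] at hy ⊢
    exact rc_T_pow_apply_eq_zero hE hcusp hy
  · rw [zpow_neg, zpow_natCast] at hy ⊢
    have hy' : T ^ n • y = y := by
      rw [inv_smul_eq_iff] at hy
      exact hy.symm
    rw [rc_inv hE, Pi.neg_apply, coperm_apply, hy, rc_T_pow_apply_eq_zero hE hcusp hy', neg_zero]

/-- **The restriction of a cocycle with vanishing cusp sums is parabolic**: if the cusp sums of
`E(T)` vanish then `E(π)(Γ) = 0` for every parabolic `π ∈ Γ` (`π = ±σT^hσ⁻¹` by the parabolic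
normal form, and `E(σT^hσ⁻¹)(Γ) = E(T^h)(σ⁻¹Γ) = 0`).
[cite: ShimuraIATAF1971, §1.3 (parabolic elements), §8.1 (8.1.4)] -/
theorem rc_apply_coe_one_eq_zero_of_isParabolic [Fact ((-1 : SL(2, ℤ)) ∈ Γ)]
    (hcusp : cuspSum Γ (E T) = 0) (γ : Γ)
    (hπ : ((γ : SL(2, ℤ)) : Matrix (Fin 2) (Fin 2) ℤ).IsParabolic) :
    E γ ((1 : SL(2, ℤ)) : (SL(2, ℤ) ⧸ Γ)) = 0 := by
  have key : ∀ g : SL(2, ℤ), g ∈ Γ → (g : Matrix (Fin 2) (Fin 2) ℤ).trace = 2 →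
      E g ((1 : SL(2, ℤ)) : (SL(2, ℤ) ⧸ Γ)) = 0 := by
    intro g hg htr
    obtain ⟨σ, h, hgeq⟩ := DepletionAtTwo.CuspEvenness.exists_eq_conj_T_zpow_of_trace_eq_two g htr
    have hfix : T ^ h • (σ⁻¹ • ((1 : SL(2, ℤ)) : (SL(2, ℤ) ⧸ Γ))) =
        σ⁻¹ • ((1 : SL(2, ℤ)) : (SL(2, ℤ) ⧸ Γ)) := by
      have h1 : T ^ h = σ⁻¹ * g * σ := by rw [hgeq]; group
      rw [h1, mul_smul, mul_smul, smul_inv_smul, smul_coe_one_of_mem hg]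
    rw [hgeq, rc_conj_apply hE σ (T ^ h) hfix]
    exact rc_T_zpow_apply_eq_zero hE hcusp hfix
  have hdisc := hπ.2
  rw [Matrix.discr_fin_two, Matrix.SpecialLinearGroup.det_coe] at hdisc
  have hmul : (((γ : SL(2, ℤ)) : Matrix (Fin 2) (Fin 2) ℤ).trace - 2) *
      (((γ : SL(2, ℤ)) : Matrix (Fin 2) (Fin 2) ℤ).trace + 2) = 0 := by
    linear_combination hdisc
  rcases mul_eq_zero.mp hmul with h2 | h2
  · exact key γ γ.2 (by linarith)
  · have hmem : -(γ : SL(2, ℤ)) ∈ Γ := by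
      rw [← neg_one_mul]
      exact Γ.mul_mem (Fact.out) γ.2
    have htr : ((-(γ : SL(2, ℤ)) : SL(2, ℤ)) : Matrix (Fin 2) (Fin 2) ℤ).trace = 2 := by
      rw [Matrix.SpecialLinearGroup.coe_neg, Matrix.trace_neg]
      linarith
    rw [← rc_neg hE (γ : SL(2, ℤ))]
    exact key _ hmem htr

end RightCocycle

/-! ### Existence of cocycles with prescribed `E(S)`, `E(T)`: the free product `C₂ * C₃` -/

variable (Γ) in
/-- The representation `g ↦ (g⁻¹)^*` of `SL(2, ℤ)` on `ℝ^X` (the left-module structure for which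
`E(gh) = h^*E(g) + E(h)` becomes `F(gh) = F(g) + ρ(g)F(h)` with `F(g) = E(g⁻¹)`). [folklore] -/
def corep : Representation ℝ SL(2, ℤ) ((SL(2, ℤ) ⧸ Γ) → ℝ) where
  toFun g := coperm Γ g⁻¹
  map_one' := by rw [inv_one, coperm_one]; rfl
  map_mul' g h := by rw [mul_inv_rev, coperm_mul]; rfl

/-- Unfolding `corep`. [folklore] -/
@[simp] theorem corep_apply (g : SL(2, ℤ)) (f : (SL(2, ℤ) ⧸ Γ) → ℝ) :
    corep Γ g f = coperm Γ g⁻¹ f := rfl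

/-- `ρ(-1) = 1` when `-1 ∈ Γ`. [folklore] -/
theorem corep_neg_one [Fact ((-1 : SL(2, ℤ)) ∈ Γ)] : corep Γ (-1) = 1 := by
  apply LinearMap.ext
  intro f
  have h : (-1 : SL(2, ℤ))⁻¹ = -1 := by
    rw [inv_eq_iff_mul_eq_one, neg_mul_neg, one_mul]
  rw [corep_apply, h, coperm_neg_one]
  rfl

/-- **Existence of cocycles.** If `(1 + S^*)a = 0` and `(1 + U^* + U^{*2})(T^*a + b) = 0`
(`U = ST`), there is a cocycle `E` of `SL(2, ℤ)` in `ℝ^X` with `E(S) = a`, `E(T) = b` — the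
universal property of `PSL(2, ℤ) = ⟨S⟩ * ⟨U⟩ ≅ C₂ * C₃`
(`ModularGroupFreeProduct.exists_isCrossedHom`). [cite: SerreTrees1980, I.4.2; Brown1982, III.1 Ex. 2] -/
theorem exists_rc [Fact ((-1 : SL(2, ℤ)) ∈ Γ)] {a b : (SL(2, ℤ) ⧸ Γ) → ℝ} (ha : relS Γ a = 0)
    (hab : relST Γ (coperm Γ T a + b) = 0) :
    ∃ E : SL(2, ℤ) → (SL(2, ℤ) ⧸ Γ) → ℝ,
      (∀ g h : SL(2, ℤ), E (g * h) = coperm Γ h (E g) + E h) ∧ E S = a ∧ E T = b := by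
  have ha' : a + coperm Γ S a = 0 := by
    simpa [relS] using ha
  have hSa : coperm Γ S a = -a := eq_neg_of_add_eq_zero_right ha'
  set c := coperm Γ T a + b with hc_def
  have hc : c + coperm Γ (S * T) c + coperm Γ (S * T) (coperm Γ (S * T) c) = 0 := by
    simpa [relST] using hab
  have h3 : ∀ v, coperm Γ (S * T) (coperm Γ (S * T) (coperm Γ (S * T) v)) = v := fun v ↦ by
    have h := LinearMap.congr_fun (coperm_ST_comp_ST_comp_ST (Γ := Γ)) v
    simpa using h
  have hP : ∀ v, coperm Γ (S * T)⁻¹ v = coperm Γ (S * T) (coperm Γ (S * T) v) := fun v ↦ by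
    have h := h3 (coperm Γ (S * T)⁻¹ v)
    rw [coperm_coperm_inv] at h
    exact h.symm
  have hSinv : (S : SL(2, ℤ))⁻¹ = -S := by
    rw [inv_eq_iff_mul_eq_one]
    decide
  have hS' : a + corep Γ S a = 0 := by
    rw [corep_apply, hSinv, coperm_neg]
    exact ha'
  have hU' : -coperm Γ (ModularGroupFreeProduct.U)⁻¹ c +
      corep Γ ModularGroupFreeProduct.U (-coperm Γ (ModularGroupFreeProduct.U)⁻¹ c) +
        corep Γ ModularGroupFreeProduct.U
          (corep Γ ModularGroupFreeProduct.U (-coperm Γ (ModularGroupFreeProduct.U)⁻¹ c)) = 0 := by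
    simp only [corep_apply, map_neg, ModularGroupFreeProduct.U_def, hP, h3]
    calc -coperm Γ (S * T) (coperm Γ (S * T) c) + -coperm Γ (S * T) c + -c
        = -(c + coperm Γ (S * T) c + coperm Γ (S * T) (coperm Γ (S * T) c)) := by abel
      _ = 0 := by rw [hc, neg_zero]
  obtain ⟨F, hF, hFS, hFU⟩ := ModularGroupFreeProduct.exists_isCrossedHom corep_neg_one hS' hU'
  have hTinv : (T : SL(2, ℤ))⁻¹ = (ModularGroupFreeProduct.U)⁻¹ * S := by
    rw [ModularGroupFreeProduct.T_eq, mul_inv_rev, inv_inv]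
  refine ⟨fun g ↦ F g⁻¹, fun g h ↦ ?_, ?_, ?_⟩
  · show F (g * h)⁻¹ = coperm Γ h (F g⁻¹) + F h⁻¹
    rw [mul_inv_rev, hF, corep_apply, inv_inv, add_comm]
  · show F S⁻¹ = a
    rw [hF.map_inv, corep_apply, inv_inv, hFS, hSa, neg_neg]
  · show F T⁻¹ = b
    rw [hTinv, hF, hF.map_inv]
    simp only [corep_apply, inv_inv, hFU, hFS, map_neg, neg_neg, coperm_coperm_inv]
    rw [ModularGroupFreeProduct.U_def, coperm_mul, LinearMap.comp_apply, hSa, map_neg, hc_def]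
    abel

end Summit.BirchSwinnertonDyer.BirchSwinnertonDyer.Theorems.EichlerShimuraLevel
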